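import Summits.BirchSwinnertonDyer.BirchSwinnertonDyer.Theorems.KatoDescentPotSupersingularFineSelmerLeSelmer
import Summits.BirchSwinnertonDyer.Rank1Residual.Additive.LocalTowerKernelDescent
import Literature.NumberTheory.EllipticCurves.Kobayashi2003.SignedSelmer
import Literature.NumberTheory.EllipticCurves.IwasawaSelmerControlCokerProofs
import Literature.NumberTheory.EllipticCurves.IwasawaSelmerDualProofs
import Literature.NumberTheory.EllipticCurves.IwasawaSelmerControlLocalizationProofs
import Literature.NumberTheory.GaloisRepresentations.AbsGaloisGroupCompact
import HarnessLib

/-!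
# Tools for `Sel₀(K_∞, E[p^∞]) ≤ Sel^±(E/K_∞)`: every class of `H¹(K_∞, E[p^∞])` comes from a layer;
# local triviality DESCENDS from `K_∞` to a finite layer `K_m` (classical and torsion coefficients);
# vanishing on `Gal(K̄/L) ⊓ D_v` gives every Kummer condition at `K_v` (route `KatoDescentPotSupersingular`,
# rung K9, cell `bsd-potss`; a `--supports … --as helper` file; seat `bsd-potss-k9-c4` g5; ROUTE-FREE;
# nothing booked, BSD is not proved by any of this)

WHY. The sibling `…FineSelmerLeSignedSelmer.lean` proves the "± ⊇ fine" kernel bridge of the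
SUPERSINGULAR-anchor road to crux stmt-BirchSwinnertonDyer-19386 (`WildFineSelmerCoatesSujatha`):
`W.fineSelmerInfty κ ≤ Kobayashi2003.signedSelmerInfty W κ ε`. In print this is a tautology
(`Sel₀(K_n) ⊆ Sel^±(E/K_n)`, `0 ∈ E^±(K_{n,v}) ⊗ ℚ_p/ℤ_p`, and `Sel₀(K_∞) = lim→ Sel₀(K_n)`); in the
kernel the tree's `Kobayashi2003.signedSelmerInfty` is the UNION OF LAYER IMAGES
`⋃ₙ res (Sel^ε(E/K_n))` while `WeierstrassCurve.fineSelmerInfty` is cut out by local conditions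
DIRECTLY over `K_∞` (Greenberg's strict Selmer group of the fine data), so the containment is the
continuity statement `H¹(K_∞, ·) = lim→ H¹(K_n, ·)` on the global and the local side. THIS FILE holds
the generic tools (any field / `ℤ_p`-extension unless said otherwise), all assembled from the tree:

* §1 `exists_layerToInfty_eq` — **every class of `H¹(K_∞, E[p^∞])` is a restriction from some
  layer `K_n`**: it is fixed by `conj_{γ^{p^a}}` for some `a` (`exists_conjH1_pow_prime_pow_eq`,
  continuity of the `Γ`-action) and Greenberg's Lemma 3.2 (`ZpExtension.mem_range_resOfLe_of_conjH1_eq`,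
  the tree's cocycle-extension proof of `coker h_n = 0`) lifts it — any `ℤ_p`-extension, no hypothesis.
* §2 `exists_conjH1_eq_conjH1_pow_of_lt` — on `H¹(K_n, E[p^∞])` the conjugation action of `Γ_K` has
  at most `p^n` values `conj_{γ^i}`, `i < p^n` (`Gal(K̄/K_n)` acts trivially).
* §3 the DESCENT of local triviality from `K_∞` to a finite layer `K_m`, `m ≥ n`, in the two shapes
  needed (the generic Cantor-intersection lemma `exists_forall_resOfLe_eq_zero_of_antitone` of
  `Additive/LocalTowerKernelDescent.lean`, there instantiated at layer `0` only): classical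
  coefficients `E(K̄_v)` on the local tower `Gal(K̄_v/K_m·K_v)` (`…_of_mem_localTowerKer`), and TORSION
  coefficients `E[p^∞]` on `Gal(K̄/K_m) ⊓ D_v ≤ Γ_K` (`…_inf_decomp_…`) for the fine condition at `v ∣ p`.
* §4 `mem_localKummerOverOfEmb_of_resOfLe_inf_decomp_eq_zero` — a class of `H¹(H, E[p^∞])` vanishing
  on `H ⊓ D_v` satisfies EVERY Kummer condition `localKummerOverOfEmb W p H (closureEmb K_v) A` (its
  cocycle is `τ ↦ τT − T` on the decomposition group with `T ∈ E[p^∞]`; witness `Q = ι(T)`,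
  `p^k Q = 0 ∈ A`); and the bridge `resOfLe_inf_decomp_eq_zero_of_mem_strictKer_fineLocalDatum` from
  Greenberg's strict kernel of the fine datum (coefficients `M ⧸ 0`, transfer lemma of g3's
  `FineSelmerLeSelmer`).

HONEST FRAMING: kernel plumbing between existing tree objects; unconditional; no named fact, no
definition; no item closed (19386/19197 stay open; class-wide = Coates–Sujatha (A), a named open
problem); no census number is an input. References: S. Kobayashi, Invent. Math. 152 (2003) Def. 1.1,
Def. 2.1 [Kobayashi2003]; R. Greenberg, LNM 1716 (1999) §3 Lemma 3.2, pp. 85–86 [GreenbergLNM1716];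
R. Greenberg, Adv. Stud. Pure Math. 17 (1989) p. 98 [Greenberg1989]; J.-P. Serre, *Galois Cohomology*
I.§2.2 Prop. 8, I.§2.6, II.§1.1 [SerreGaloisCohomology1997]; L. Washington, GTM 83, §13.1 [Washington1997].
-/

set_option autoImplicit false
-- sibling precedent (`KatoDescentPotSupersingularAssembly.lean`): the directory name repeats the summit name
set_option linter.dupNamespace false

noncomputable section

open scoped Classical

universe u

namespace Summit.BirchSwinnertonDyer.BirchSwinnertonDyer.Theorems.FineSelmerLeSignedSelmer

open CategoryTheory NumberField IsDedekindDomain Field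
open Literature.NumberTheory.EllipticCurves Literature.NumberTheory.EllipticCurves.GreenbergSelmer
  Literature.NumberTheory.EllipticCurves.Kobayashi2003 Literature.NumberTheory.EllipticCurves.ZpExtension
  Literature.NumberTheory.GaloisRepresentations
  Summit.BirchSwinnertonDyer.Rank1Residual.Additive
  Summit.BirchSwinnertonDyer.BirchSwinnertonDyer.Theorems

/-! ## §1 `H¹(K_∞, E[p^∞]) = ⋃ₙ res H¹(K_n, E[p^∞])` — every class comes from a layer -/

section Global

variable {K : Type u} [Field K] [NumberField K] (W : WeierstrassCurve K) {p : ℕ} [Fact p.Prime]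
  (κ : ZpExtension K p)

omit [NumberField K] [Fact p.Prime] in
/-- Points of `E[p^∞]` are `p`-power torsion (unfolding of `geomPrimaryTorsion`). [folklore] -/
theorem exists_pow_smul_geomPrimaryTorsion_eq_zero (m : W.geomPrimaryTorsion p) :
    ∃ k : ℕ, p ^ k • m = 0 := by
  obtain ⟨k, hk⟩ := m.2
  exact ⟨k, Subtype.ext (by rw [AddSubgroupClass.coe_nsmul, hk, ZeroMemClass.coe_zero])⟩

/-- **Every class of `H¹(K_∞, E[p^∞])` is a restriction from a finite layer**: for
`c ∈ H¹(Gal(K̄/K_∞), E[p^∞])` there are `n` and `y ∈ H¹(Gal(K̄/K_n), E[p^∞])` with `h_n(y) = c` — the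
surjectivity half of `H¹(K_∞, ·) = lim→ H¹(K_n, ·)` (Serre I.§2.2 Prop. 8). In the tree: `c` is fixed by
`conj_{γ^{p^a}}` for some `a` (`exists_conjH1_pow_prime_pow_eq`) and Greenberg's Lemma 3.2
(`ZpExtension.mem_range_resOfLe_of_conjH1_eq`) lifts every such class. Any number field, any `p`,
any `ℤ_p`-extension. [cite: SerreGaloisCohomology1997, I.§2.2 Prop. 8] [cite: GreenbergLNM1716, §3 Lemma 3.2 (p. 86)] -/
theorem exists_layerToInfty_eq (c : W.subgroupH1 p κ.kerSubgroup) :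
    ∃ (n : ℕ) (y : W.subgroupH1 p (κ.layerSubgroup n)), W.layerToInfty κ n y = c := by
  obtain ⟨γ, hγ⟩ := κ.surjective (Multiplicative.ofAdd 1)
  have hγ' : κ.IsTopGenerator γ := hγ
  obtain ⟨a, ha⟩ := W.exists_conjH1_pow_prime_pow_eq κ hγ' c
  obtain ⟨y, hy⟩ := ZpExtension.mem_range_resOfLe_of_conjH1_eq κ hγ' a
    (W.continuous_smul_geomPrimaryTorsion p) (exists_pow_smul_geomPrimaryTorsion_eq_zero W) c ha
  exact ⟨a, y, hy⟩

end Global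

/-! ## §2 Conjugation on `H¹(K_n, E[p^∞])` factors through `Γ_K / Gal(K̄/K_n) ≅ ℤ/p^n` -/

section Reps

variable {K : Type u} [Field K] (W : WeierstrassCurve K) {p : ℕ} [Fact p.Prime]
  (κ : ZpExtension K p)

/-- For a topological generator `γ` (`κ γ = 1`) and any `σ ∈ Γ_K` there is `i < p^n` with
`(γ^i)⁻¹ σ ∈ Gal(K̄/K_n) = κ⁻¹(p^n ℤ_p)` (`i ≡ κ σ (mod p^n)`, `PadicInt.appr`).
[cite: Washington1997, §13.1] -/
theorem exists_lt_pow_inv_mul_mem_layerSubgroup {γ : absoluteGaloisGroup K} (hγ : κ.IsTopGenerator γ)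
    (n : ℕ) (σ : absoluteGaloisGroup K) :
    ∃ i : ℕ, i < p ^ n ∧ (γ ^ i)⁻¹ * σ ∈ κ.layerSubgroup n := by
  set z : ℤ_[p] := (κ σ).toAdd with hz
  refine ⟨z.appr n, PadicInt.appr_lt z n, ?_⟩
  have hγ' : κ γ = Multiplicative.ofAdd 1 := hγ
  rw [ZpExtension.mem_layerSubgroup, map_mul, map_inv, map_pow, hγ', toAdd_mul, toAdd_inv,
    ← ofAdd_nsmul, toAdd_ofAdd, nsmul_eq_mul, mul_one]
  have h := PadicInt.appr_spec n z
  rw [Ideal.mem_span_singleton] at h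
  have e : -((z.appr n : ℕ) : ℤ_[p]) + (κ σ).toAdd = z - (z.appr n : ℕ) := by rw [hz]; ring
  rw [e]
  exact h

/-- **On `H¹(K_n, E[p^∞])` every `conj_σ` is some `conj_{γ^i}` with `i < p^n`** (`σ = γ^i τ` with
`τ ∈ Gal(K̄/K_n)`, which acts trivially: inner automorphisms, `conjH1_of_mem`).
[cite: SerreLocalFields1979, VII.§5 Prop. 3] -/
theorem exists_conjH1_eq_conjH1_pow_of_lt {γ : absoluteGaloisGroup K} (hγ : κ.IsTopGenerator γ)
    (n : ℕ) (σ : absoluteGaloisGroup K) (y : W.subgroupH1 p (κ.layerSubgroup n)) :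
    ∃ i : ℕ, i < p ^ n ∧
      W.conjH1 p (κ.layerSubgroup n) σ y = W.conjH1 p (κ.layerSubgroup n) (γ ^ i) y := by
  obtain ⟨i, hi, hτ⟩ := exists_lt_pow_inv_mul_mem_layerSubgroup κ hγ n σ
  refine ⟨i, hi, ?_⟩
  conv_lhs => rw [← mul_inv_cancel_left (γ ^ i) σ]
  rw [W.conjH1_mul_holds p (κ.layerSubgroup n), AddMonoidHom.comp_apply,
    W.conjH1_of_mem_holds p (κ.layerSubgroup n) hτ, AddMonoidHom.id_apply]

end Reps

/-! ## §3 Descent of local triviality from `K_∞` to a finite layer `K_m`, `m ≥ n` -/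

section DescentPoints

variable {K : Type u} [Field K] (W : WeierstrassCurve K) {p : ℕ} [Fact p.Prime]
  (κ : ZpExtension K p) (E : Type u) [Field E] [Algebra K E]

/-- **Classical coefficients, layer `n`.** If a class `x ∈ H¹(Gal(K̄_E/K_n·E), E(K̄_E))` dies on
`Gal(K̄_E/K_∞·E)` (`x ∈ 𝒦_{E,n}`, `WeierstrassCurve.localTowerKer κ E n`), then it dies on
`Gal(K̄_E/K_m·E)` for all large `m ≥ n` — the layer-`n` form of file 44's
`exists_forall_resOfLe_localSubgroup_eq_zero_of_mem_localTowerKer_zero` (same generic Cantor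
intersection lemma, tower `j ↦ Gal(K̄_E/K_{n+j}·E)`). [cite: GreenbergLNM1716, §3 p. 86]
[cite: SerreGaloisCohomology1997, I.§2.2 Prop. 8] -/
theorem exists_forall_resOfLe_localSubgroup_eq_zero_of_mem_localTowerKer (n : ℕ)
    {x : discreteH1 (localSubgroup (κ.layerSubgroup n) E) (localPoints W E)}
    (hx : x ∈ W.localTowerKer κ E n) :
    ∃ m₀ : ℕ, ∀ (m : ℕ) (hnm : n ≤ m), m₀ ≤ m →
      Literature.NumberTheory.EllipticCurves.resOfLe (localPoints W E)
        (Subgroup.comap_mono (κ.layerSubgroup_antitone hnm) :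
          localSubgroup (κ.layerSubgroup m) E ≤ localSubgroup (κ.layerSubgroup n) E) x = 0 := by
  haveI : CompactSpace (absoluteGaloisGroup E) := absoluteGaloisGroup_compactSpace E
  obtain ⟨j₀, hj₀⟩ := exists_forall_resOfLe_eq_zero_of_antitone
    (H' := localSubgroup (κ.layerSubgroup n) E)
    (fun j ↦ localSubgroup (κ.layerSubgroup (n + j)) E)
    (fun _ _ h ↦ Subgroup.comap_mono (κ.layerSubgroup_antitone (Nat.add_le_add_left h n)))
    (fun j ↦ Subgroup.comap_mono (κ.layerSubgroup_antitone (Nat.le_add_right n j)))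
    (fun j ↦ isClosed_localSubgroup_layerSubgroup κ E (n + j))
    (Hinf := localSubgroup κ.kerSubgroup E)
    (fun j ↦ WeierstrassCurve.localSubgroup_ker_le_layer κ E (n + j))
    (fun τ hτ ↦ mem_localSubgroup_kerSubgroup_of_forall κ E fun j ↦
      Subgroup.comap_mono (κ.layerSubgroup_antitone (Nat.le_add_left j n)) (hτ j))
    (continuous_smul_localPoints W E) hx
  refine ⟨n + j₀, fun m hnm hm ↦ ?_⟩
  obtain ⟨j, rfl⟩ := Nat.exists_eq_add_of_le hnm
  exact hj₀ j (Nat.le_of_add_le_add_left hm)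

end DescentPoints

section DescentTorsion

variable {K : Type u} [Field K] [NumberField K] (W : WeierstrassCurve K) {p : ℕ} [Fact p.Prime]
  (κ : ZpExtension K p) (v : HeightOneSpectrum (𝓞 K))

/-- The decomposition group `D_v ≤ Γ_K` of the chosen prime above `v` is closed (continuous image of
the compact `Γ_{K_v}`). [cite: NeukirchANT1999, Ch. II §9 Prop. (9.6)] -/
theorem isClosed_decomp : IsClosed (decomp v : Set (absoluteGaloisGroup K)) := by
  haveI : CompactSpace (absoluteGaloisGroup (v.adicCompletion K)) :=
    absoluteGaloisGroup_compactSpace (v.adicCompletion K)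
  exact (isCompact_range (absGaloisRestrict K (v.adicCompletion K)).continuous).isClosed

/-- **Torsion coefficients, layer `n`, inside `Γ_K`.** If a class `x ∈ H¹(Gal(K̄/K_n), E[p^∞])`
vanishes on `Gal(K̄/K_∞) ⊓ D_v` (locally trivial at the place of `K_∞` above `v` singled out by the
chosen embedding, with TORSION coefficients — the fine condition), then it vanishes on
`Gal(K̄/K_m) ⊓ D_v` for all large `m ≥ n`: the generic descent on the compact `Γ_K` for the tower of
closed subgroups `j ↦ κ⁻¹(p^{n+j}ℤ_p) ⊓ D_v`, whose intersection is `ker κ ⊓ D_v`.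
[cite: SerreGaloisCohomology1997, I.§2.2 Prop. 8] [cite: Greenberg1989, §1 p. 98] -/
theorem exists_forall_resOfLe_inf_decomp_eq_zero (n : ℕ) {x : W.subgroupH1 p (κ.layerSubgroup n)}
    (hx : W.resOfLe p (inf_le_left.trans (κ.kerSubgroup_le_layerSubgroup n) :
      κ.kerSubgroup ⊓ decomp v ≤ κ.layerSubgroup n) x = 0) :
    ∃ m₀ : ℕ, ∀ (m : ℕ) (hnm : n ≤ m), m₀ ≤ m →
      W.resOfLe p (inf_le_left.trans (κ.layerSubgroup_antitone hnm) :
        κ.layerSubgroup m ⊓ decomp v ≤ κ.layerSubgroup n) x = 0 := by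
  haveI : CompactSpace (absoluteGaloisGroup K) := absoluteGaloisGroup_compactSpace K
  obtain ⟨j₀, hj₀⟩ := exists_forall_resOfLe_eq_zero_of_antitone (M := W.geomPrimaryTorsion p)
    (H' := κ.layerSubgroup n)
    (fun j ↦ κ.layerSubgroup (n + j) ⊓ decomp v)
    (fun _ _ h ↦ inf_le_inf_right _ (κ.layerSubgroup_antitone (Nat.add_le_add_left h n)))
    (fun j ↦ inf_le_left.trans (κ.layerSubgroup_antitone (Nat.le_add_right n j)))
    (fun j ↦ (Subgroup.isClosed_of_isOpen _ (κ.isOpen_layerSubgroup (n + j))).inter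
      (isClosed_decomp v))
    (Hinf := κ.kerSubgroup ⊓ decomp v)
    (fun j ↦ inf_le_inf_right _ (κ.kerSubgroup_le_layerSubgroup (n + j)))
    (fun g hg ↦ Subgroup.mem_inf.mpr ⟨mem_kerSubgroup_of_forall_mem_layerSubgroup' κ fun j ↦
        κ.layerSubgroup_antitone (Nat.le_add_left j n) (Subgroup.mem_inf.mp (hg j)).1,
      (Subgroup.mem_inf.mp (hg 0)).2⟩)
    (W.continuous_smul_geomPrimaryTorsion p) hx
  refine ⟨n + j₀, fun m hnm hm ↦ ?_⟩
  obtain ⟨j, rfl⟩ := Nat.exists_eq_add_of_le hnm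
  exact hj₀ j (Nat.le_of_add_le_add_left hm)

end DescentTorsion

/-! ## §4 Vanishing on `H ⊓ D_v` (torsion coefficients): from the fine datum, and to every Kummer condition -/

section Kummer

variable {K : Type u} [Field K] [NumberField K] (W : WeierstrassCurve K) (p : ℕ)
  (H : Subgroup (absoluteGaloisGroup K)) (v : HeightOneSpectrum (𝓞 K))

/-- An element of the local subgroup `Gal(K̄_v/L_w) ≤ Γ_{K_v}` restricts into `H ⊓ D_v` (`D_v` is by
definition the range of `Γ_{K_v} → Γ_K`, and `resGal = absGaloisRestrict`). [cite: GreenbergLNM1716, §2] -/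
theorem resGalOfEmb_mem_inf_decomp
    (τ : localSubgroupOfEmb H (closureEmb (K := K) (v.adicCompletion K))) :
    resGalOfEmb (closureEmb (K := K) (v.adicCompletion K)) (τ : absoluteGaloisGroup (v.adicCompletion K)) ∈
      H ⊓ decomp v := by
  refine Subgroup.mem_inf.mpr ⟨τ.2, ?_⟩
  rw [mem_decomp_iff]
  exact ⟨τ, by rw [← WeierstrassCurve.resGal_eq_absGaloisRestrict, resGal_eq]⟩

/-- **The STRICT condition of the fine datum is vanishing on `H ⊓ D_v` with coefficients `E[p^∞]`.**
Greenberg's strict map of `fineLocalDatum` (`M⁺_v = 0`) restricts to `H ⊓ D_v` (as a subgroup of the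
subtype `D_v`) with the BIJECTIVE coefficient map `M → M ⧸ 0`; the transfer
`FineSelmerLeSelmer.resH1Hom_eq_zero_of_resH1Hom_eq_zero_of_range` moves its kernel to the plain
restriction `H¹(H, E[p^∞]) → H¹(H ⊓ D_v, E[p^∞])`. [cite: Greenberg1989, §1 p. 98] -/
theorem resOfLe_inf_decomp_eq_zero_of_mem_strictKer_fineLocalDatum {c : W.subgroupH1 p H}
    (hc : c ∈ (fineLocalDatum (W.geomPrimaryTorsion p) v).strictKer H) :
    W.resOfLe p (inf_le_left : H ⊓ decomp v ≤ H) c = 0 := by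
  have hc0 : resH1Hom (decompInToH H v) (fineLocalDatum (W.geomPrimaryTorsion p) v).grMk
      (fun _ _ ↦ rfl) c = 0 := (LocalDatum.mem_strictKer_iff _ _ c).1 hc
  have hbij : Function.Bijective (fineLocalDatum (W.geomPrimaryTorsion p) v).grMk := by
    refine ⟨?_, (fineLocalDatum (W.geomPrimaryTorsion p) v).grMk_surjective⟩
    rw [← AddMonoidHom.ker_eq_bot_iff, LocalDatum.ker_grMk, fineLocalDatum_plus]
  have hrange : ∀ l : ↥(H ⊓ decomp v), ∃ l₁ : decompIn H v, decompInToH H v l₁ =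
      subgroupInclusion (inf_le_left : H ⊓ decomp v ≤ H) l := fun l ↦
    ⟨⟨⟨(l : absoluteGaloisGroup K), (Subgroup.mem_inf.mp l.2).2⟩,
      (mem_decompIn_iff H v _).2 (Subgroup.mem_inf.mp l.2).1⟩, Subtype.ext rfl⟩
  exact FineSelmerLeSelmer.resH1Hom_eq_zero_of_resH1Hom_eq_zero_of_range _ _ _ hbij _ _ _ hrange c hc0

/-- **Vanishing on `H ⊓ D_v` gives EVERY Kummer condition at `K_v`.** If `z ∈ H¹(H, E[p^∞])`
restricts to `0` on `H ⊓ D_v`, then for every subgroup `A ≤ E(K̄_v)` the class `z` lies in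
`localKummerOverOfEmb W p H (closureEmb K_v) A`: a cocycle of `z` is `g ↦ g•T − T` on `H ⊓ D_v` for
some `T ∈ E[p^∞]` (identity coefficient map is bijective), hence `τ ↦ τ•Q − Q` on `Gal(K̄_v/L_w)`
with the TORSION witness `Q = ι(T)`, `p^k Q = 0 ∈ A`. (The Kummer image of `0 = p^k Q ⊗ p^{-k}`.)
[cite: Kobayashi2003, Def. 1.1 (p. 2) and Def. 2.1 (p. 5)] [cite: GreenbergLNM1716, §2 (pp. 62–63)] -/
theorem mem_localKummerOverOfEmb_of_resOfLe_inf_decomp_eq_zero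
    (A : AddSubgroup (localPoints W (v.adicCompletion K))) {z : W.subgroupH1 p H}
    (hz : W.resOfLe p (inf_le_left : H ⊓ decomp v ≤ H) z = 0) :
    z ∈ localKummerOverOfEmb W p H (closureEmb (K := K) (v.adicCompletion K)) A := by
  obtain ⟨φ, rfl⟩ := oneCocycleClass_surjective _ z
  obtain ⟨T, hT⟩ := FineSelmerLeSelmer.exists_principal_of_resH1Hom_oneCocycleClass_eq_zero
    (subgroupInclusion (inf_le_left : H ⊓ decomp v ≤ H)) (AddMonoidHom.id (W.geomPrimaryTorsion p))
    (fun _ _ ↦ rfl) Function.bijective_id φ hz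
  obtain ⟨k, hk⟩ := T.2
  refine ⟨φ, pointsMapOfEmb W (closureEmb (K := K) (v.adicCompletion K))
    ((T : W.geomPrimaryTorsion p) : W.geomPoints), k, rfl, ?_, fun τ ↦ ?_⟩
  · rw [← map_nsmul, hk, map_zero]
    exact zero_mem A
  · have hτ := hT ⟨_, resGalOfEmb_mem_inf_decomp H v τ⟩
    have hτ' : ((φ.1 (resGalSubgroupOfEmb H (closureEmb (K := K) (v.adicCompletion K)) τ) :
        W.geomPrimaryTorsion p) : W.geomPoints) =
        resGalOfEmb (closureEmb (K := K) (v.adicCompletion K))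
            (τ : absoluteGaloisGroup (v.adicCompletion K)) • ((T : W.geomPrimaryTorsion p) : W.geomPoints) -
          ((T : W.geomPrimaryTorsion p) : W.geomPoints) := by
      have e : resGalSubgroupOfEmb H (closureEmb (K := K) (v.adicCompletion K)) τ =
          subgroupInclusion (inf_le_left : H ⊓ decomp v ≤ H) ⟨_, resGalOfEmb_mem_inf_decomp H v τ⟩ :=
        Subtype.ext rfl
      rw [e, hτ, AddSubgroupClass.coe_sub, Literature.NumberTheory.EllipticCurves.primaryComponent.coe_smul]
      rfl
    rw [hτ', map_sub, pointsMapOfEmb_smul]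

end Kummer

end Summit.BirchSwinnertonDyer.BirchSwinnertonDyer.Theorems.FineSelmerLeSignedSelmer

end
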